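import Summits.AtomisticToContinuum.BoseEinsteinCondensation.Theses.BECDyadicChaining

/-!
# Line `firstorder_window` — crux `DyadicCoherenceDefect` (stmt-AtomisticToContinuum-13192), route `BECDyadicChaining`

Crux-strategist ALTERNATIVE line (2026-08-17; published under `Lines/firstorder_window.lean`, NOT
registered with `ledger skeleton check` so as not to replace the lead's live skeleton
`Lines/registered.lean`). Same window/above-window architecture as `registered`, with the
window-exponent quantifier SWAPPED between the open stub and the local-condensation stub:

* `registered`: S1 `DefectAboveWindow` = **∃ η ∈ (0,1/4)** (open) + S3 = route item
  `WindowLocalCondensation` (stmt-13194) = **∀ η ∈ (0,1/4)**: local condensation with depletion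
  `≤ C(ρa³)^γ max(1, ρas²) N`, `γ > 2η`. Because S3 quantifies EVERY `η < 1/4`, at `η → 1/4` it needs
  `γ → 1/2`, i.e. Lee–Huang–Yang-SHARP depletion bounds cell-wise in a Dirichlet near-minimiser
  (XL, not in print — the item's own why-might-fail).
* `firstorder_window` (this file): S1′ `DefectAboveEveryWindow` = **∀ η ∈ (0,1/4)** (open; an
  engine above the window is insensitive to η — larger η means FEWER levels) + S3′
  `FirstOrderLocalCondensation` = **∃ η > 0** (same body as stmt-13194 at ONE exponent). At a small
  exponent FIRST-ORDER energy precision suffices: LSSY2005 (5.15) gives depletion fraction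
  `≲ ρ a s² Y^{1/17} + Y^{1/17}` (`Y = ρa³`) in a box of side `s`, i.e. condensation up to
  `s ≍ (ρa)^{-1/2} Y^{-1/34}`; its two ingredients, Lemma 4.1 (generalized Poincaré,
  `LSSY2005_lemma41_holds`) and Lemma 5.2 (localization of energy, `LSSY2005_lemma52_periodic_holds`),
  are PROVED in the tree, as are the Dyson upper bound `eventually_groundStateEnergy_le_dyson` and the
  LY cell machinery. S3′ is implied by stmt-13194 (instantiate `η = 1/8`): theorem
  `firstOrderLocalCondensation_of_windowLocalCondensation` below (sorry-free), so this line is never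
  worse than `registered`, and it survives a `stub-blocked`/refutation of stmt-13194 at large `η`.
* S2 `stub_levelIncrement` is the registered S2 VERBATIM (same name, same signature): one landed proof
  serves both lines. S4′ `stub_windowBudgetFO` is the registered S4 bookkeeping with the second
  exponent `η'` replaced by halving the delivered one (`η₂ = min(η₁/2, 1/8)`, parent of a window level
  is in the `η₁`-window once `Y^{-(η₁-η₂)} ≥ 2`).

Composition `DyadicCoherenceDefect_of` (sorry-free): `(η, ℓ_d)` from the window part
`DefectInSomeWindow` (= S4′ S2 S3′), S1′ at that `(η, ℓ_d)`, `ρ₀ = min`, `β = β¹ + β²`, eventualities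
intersected, `δ = min`, per-level split `s_w < L/2^m ∨ L/2^m ≤ s_w`. Conclusion = the route decl
`Summit.AtomisticToContinuum.BoseEinsteinCondensation.Theses.BECDyadicChaining.DyadicCoherenceDefect` BY NAME.

Disproof used: none exists for this crux (`ledger crux ls stmt-AtomisticToContinuum-13192`, 2026-08-17:
Lines/{birth,registered}, PICKED.md only); negatives index (20): nothing on block occupations.
-/

noncomputable section

open Filter
open scoped ENNReal NNReal BigOperators

namespace Summit.AtomisticToContinuum.BoseEinsteinCondensation.Cruxes.DyadicCoherenceDefect.FirstOrderWindow

open Literature.MathematicalPhysics.QuantumManyBody.BoseGas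
open Summit.AtomisticToContinuum.BoseEinsteinCondensation.Theses

-- BEGIN DEFS

/-- **S1′ statement — coherence defect above EVERY window (open; the hardest stub).** For every
repulsive finite-range `v`, EVERY window exponent `η ∈ (0, 1/4)` and every bracket base `ℓ_d > 0`
there is `ρ₀ > 0` with: for `0 < ρ < ρ₀` a budget `β ≥ 0`, `Σ_j β_j ≤ 1/8`, such that for all large
`N`, some `δ > 0` and every `δ`-near-minimiser `Ψ` of the Dirichlet box of side `L = (N/ρ)^{1/3}`,
every level `m ≥ 1` whose cube side `L/2^m` lies in `[ℓ_d 2^j, ℓ_d 2^{j+1})` AND exceeds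
`s_w(ρ, η) = (ρa)^{-1/2}(ρa³)^{-η}` (`a = scatteringLength v`, real part) has `A_m ≤ A_{m-1} + β_j √N`.
The registered S1 is the `∃ η` form of the same statement. [cite: arXiv:2603.20776, Rem. 7; Leggett2001, §VI] -/
def DefectAboveEveryWindow : Prop :=
  ∀ v : ℝ → ℝ≥0∞, IsRepulsiveFiniteRange v → ∀ η : ℝ, 0 < η → η < 1 / 4 → ∀ ℓd : ℝ, 0 < ℓd →
    ∃ ρ₀ : ℝ, 0 < ρ₀ ∧ ∀ ρ : ℝ, 0 < ρ → ρ < ρ₀ →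
      ∃ β : ℕ → ℝ, (∀ j, 0 ≤ β j) ∧ Summable β ∧ ∑' j, β j ≤ 1 / 8 ∧ ∀ᶠ N : ℕ in atTop,
        let a : ℝ := (scatteringLength v).toReal
        let L : ℝ := sideLength ρ N
        let φ : (m : ℕ) → (Fin 3 → Fin (2 ^ m)) → EuclideanSpace ℝ (Fin 3) → ℂ := fun m i =>
          Set.indicator {x : EuclideanSpace ℝ (Fin 3) | ∀ k : Fin 3, x k ∈
              Set.Ioo (((i k : ℕ) : ℝ) * (L / 2 ^ m)) ((((i k : ℕ) : ℝ) + 1) * (L / 2 ^ m))}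
            (fun _ => ((Real.sqrt ((L / 2 ^ m) ^ 3))⁻¹ : ℂ))
        ∃ δ : ℝ≥0∞, 0 < δ ∧ ∀ Ψ : TrialState N L, energy v Ψ ≤ groundStateEnergy v N L + δ →
          let A : ℕ → ℝ≥0∞ := fun m => (8 : ℝ≥0∞) ^ (-(m : ℝ) / 2) *
            ∑ i : Fin 3 → Fin (2 ^ m), (occupation N (φ m i) Ψ.ψ) ^ (1 / 2 : ℝ)
          ∀ m j : ℕ, 1 ≤ m → ℓd * 2 ^ j ≤ L / 2 ^ m → L / 2 ^ m < ℓd * 2 ^ (j + 1) →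
            (ρ * a) ^ (-(1 : ℝ) / 2) * (ρ * a ^ 3) ^ (-η) < L / 2 ^ m →
            A m ≤ A (m - 1) + ENNReal.ofReal (β j) * (N : ℝ≥0∞) ^ (1 / 2 : ℝ)

/-- **Window part of the crux at SOME exponent** (derived from S2, S3′, S4′; not itself a stub). For
every repulsive finite-range `v` there are `η ∈ (0, 1/4)` and `ℓ_d > 0`, `ρ₀ > 0` with: for
`0 < ρ < ρ₀` a budget `β ≥ 0`, `Σ_j β_j ≤ 1/8`, such that for all large `N`, some `δ > 0` and every
`δ`-near-minimiser, every level `m ≥ 1` in bracket `j` with cube side `L/2^m ≤ s_w(ρ, η)` has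
`A_m ≤ A_{m-1} + β_j √N`. [cite: LSSY2005, Thm. 5.1 and (5.15); Fournais2020, Thm. 1.2] -/
def DefectInSomeWindow : Prop :=
  ∀ v : ℝ → ℝ≥0∞, IsRepulsiveFiniteRange v → ∃ η : ℝ, 0 < η ∧ η < 1 / 4 ∧ ∃ ℓd : ℝ, 0 < ℓd ∧
    ∃ ρ₀ : ℝ, 0 < ρ₀ ∧ ∀ ρ : ℝ, 0 < ρ → ρ < ρ₀ →
      ∃ β : ℕ → ℝ, (∀ j, 0 ≤ β j) ∧ Summable β ∧ ∑' j, β j ≤ 1 / 8 ∧ ∀ᶠ N : ℕ in atTop,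
        let a : ℝ := (scatteringLength v).toReal
        let L : ℝ := sideLength ρ N
        let φ : (m : ℕ) → (Fin 3 → Fin (2 ^ m)) → EuclideanSpace ℝ (Fin 3) → ℂ := fun m i =>
          Set.indicator {x : EuclideanSpace ℝ (Fin 3) | ∀ k : Fin 3, x k ∈
              Set.Ioo (((i k : ℕ) : ℝ) * (L / 2 ^ m)) ((((i k : ℕ) : ℝ) + 1) * (L / 2 ^ m))}
            (fun _ => ((Real.sqrt ((L / 2 ^ m) ^ 3))⁻¹ : ℂ))
        ∃ δ : ℝ≥0∞, 0 < δ ∧ ∀ Ψ : TrialState N L, energy v Ψ ≤ groundStateEnergy v N L + δ →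
          let A : ℕ → ℝ≥0∞ := fun m => (8 : ℝ≥0∞) ^ (-(m : ℝ) / 2) *
            ∑ i : Fin 3 → Fin (2 ^ m), (occupation N (φ m i) Ψ.ψ) ^ (1 / 2 : ℝ)
          ∀ m j : ℕ, 1 ≤ m → ℓd * 2 ^ j ≤ L / 2 ^ m → L / 2 ^ m < ℓd * 2 ^ (j + 1) →
            L / 2 ^ m ≤ (ρ * a) ^ (-(1 : ℝ) / 2) * (ρ * a ^ 3) ^ (-η) →
            A m ≤ A (m - 1) + ENNReal.ofReal (β j) * (N : ℝ≥0∞) ^ (1 / 2 : ℝ)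

/-- **S2 statement — the level-occupation ladder and the increment bound** (VERBATIM the registered
line's `LevelIncrement`; one proof serves both lines). For every `N`, `L`, every Dirichlet trial state
`Ψ` and every level `m ≥ 1`, with `T_m = Σ_{C ∈ level m} ⟨φ_C, γ_Ψ φ_C⟩` and
`A_m = 8^{-m/2} Σ_C √⟨φ_C, γ_Ψ φ_C⟩`: `T_{m-1} ≤ T_m ≤ N` and `A_m ≤ A_{m-1} + √(T_m − T_{m-1})`
(truncated subtraction in `ℝ≥0∞`). [cite: LSSY2005, §1.2 (1.17)] -/
def LevelIncrement : Prop :=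
  ∀ (N : ℕ) (L : ℝ) (Ψ : TrialState N L) (m : ℕ), 1 ≤ m →
    let φ : (m : ℕ) → (Fin 3 → Fin (2 ^ m)) → EuclideanSpace ℝ (Fin 3) → ℂ := fun m i =>
      Set.indicator {x : EuclideanSpace ℝ (Fin 3) | ∀ k : Fin 3, x k ∈
          Set.Ioo (((i k : ℕ) : ℝ) * (L / 2 ^ m)) ((((i k : ℕ) : ℝ) + 1) * (L / 2 ^ m))}
        (fun _ => ((Real.sqrt ((L / 2 ^ m) ^ 3))⁻¹ : ℂ))
    let T : ℕ → ℝ≥0∞ := fun m => ∑ i : Fin 3 → Fin (2 ^ m), occupation N (φ m i) Ψ.ψ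
    let A : ℕ → ℝ≥0∞ := fun m => (8 : ℝ≥0∞) ^ (-(m : ℝ) / 2) *
      ∑ i : Fin 3 → Fin (2 ^ m), (occupation N (φ m i) Ψ.ψ) ^ (1 / 2 : ℝ)
    T (m - 1) ≤ T m ∧ T m ≤ N ∧ A m ≤ A (m - 1) + (T m - T (m - 1)) ^ (1 / 2 : ℝ)

/-- **S3′ statement — local condensation of the thermodynamic near-minimisers on all dyadic scales up
to SOME window `(ρa)^{-1/2}(ρa³)^{-η}`, `η > 0` (first-order precision).** For every repulsive
finite-range `v` there are `η > 0`, `γ > 2η`, `C ≥ 0` and `ρ₀ > 0` such that for `0 < ρ < ρ₀`, all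
large `N`, some `δ > 0` and every `δ`-near-minimiser `Ψ` of the Dirichlet box of side
`L = (N/ρ)^{1/3}`: for every level `m` with cube side `s = L/2^m ≤ (ρa)^{-1/2}(ρa³)^{-η}`,
`Σ_{C ∈ level m} ⟨φ_C, γ_Ψ φ_C⟩ ≥ (1 − C(ρa³)^γ max(1, ρ a s²)) N`. This is the route item
`WindowLocalCondensation` (stmt-13194) with `∀ η ∈ (0,1/4)` weakened to `∃ η > 0`
(`firstOrderLocalCondensation_of_windowLocalCondensation`); at `η < 1/34` it is first-order:
LSSY2005 Lemma 5.2 (`LSSY2005_lemma52_periodic_holds`) + Lemma 4.1 (`LSSY2005_lemma41_holds`) applied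
cell-wise, depletion fraction `≲ ρ a s² Y^{1/17} + Y^{1/17}` as in (5.15), plus monotonicity of
`T_m` in `m` (`cohSum_le_cohSum_succ`) for the levels below the LY cell scale. Vacuous for `a = 0`.
[cite: LSSY2005, Lemma 5.2, Lemma 4.1, (5.15); Fournais2020, Thm. 1.2] -/
def FirstOrderLocalCondensation : Prop :=
  ∀ v : ℝ → ℝ≥0∞, IsRepulsiveFiniteRange v → ∃ η γ C : ℝ, 0 < η ∧ 2 * η < γ ∧ 0 ≤ C ∧
    ∃ ρ₀ : ℝ, 0 < ρ₀ ∧ ∀ ρ : ℝ, 0 < ρ → ρ < ρ₀ → ∀ᶠ N : ℕ in atTop,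
      let a : ℝ := (scatteringLength v).toReal
      let L : ℝ := sideLength ρ N
      let φ : (m : ℕ) → (Fin 3 → Fin (2 ^ m)) → EuclideanSpace ℝ (Fin 3) → ℂ := fun m i =>
        Set.indicator {x : EuclideanSpace ℝ (Fin 3) | ∀ k : Fin 3, x k ∈
            Set.Ioo (((i k : ℕ) : ℝ) * (L / 2 ^ m)) ((((i k : ℕ) : ℝ) + 1) * (L / 2 ^ m))}
          (fun _ => ((Real.sqrt ((L / 2 ^ m) ^ 3))⁻¹ : ℂ))
      ∃ δ : ℝ≥0∞, 0 < δ ∧ ∀ Ψ : TrialState N L, energy v Ψ ≤ groundStateEnergy v N L + δ →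
        ∀ m : ℕ, L / 2 ^ m ≤ (ρ * a) ^ (-(1 : ℝ) / 2) * (ρ * a ^ 3) ^ (-η) →
          ENNReal.ofReal ((1 - C * (ρ * a ^ 3) ^ γ * max 1 (ρ * a * (L / 2 ^ m) ^ 2)) * N) ≤
            ∑ i : Fin 3 → Fin (2 ^ m), occupation N (φ m i) Ψ.ψ

/-- **S4′ statement — the window budget at the delivered exponent.** The level ladder (S2) and
first-order local condensation (S3′, exponent `η₁`, constants `γ > 2η₁`, `C`) give the window part of
the crux at `η₂ = min(η₁/2, 1/8)` with budget `Σ ≤ 1/8`: a window level `m` (cube side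
`s_m ≤ s_w(η₂)`) has its parent in the `η₁`-window once `(ρa³)^{-(η₁-η₂)} ≥ 2`, so
`defect_m ≤ √(T_m − T_{m-1}) ≤ √(N − T_{m-1}) ≤ √(C(ρa³)^γ max(1, 4ρa s_m²)) √N`; with
`β_j := √(C(ρa³)^γ max(1, 16ρaℓ_d²4^j))·[ℓ_d 2^j ≤ s_w(η₂)]` (`ℓ_d := 1`) one gets
`Σ_j β_j ≲ √C (ρa³)^{γ/2}(log₂ s_w(η₂) + 1 + 8(ρa³)^{-η₂}) → 0` as `ρ → 0` since `γ > 2η₁ ≥ 2η₂`;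
`a = 0` or `a = ⊤` (`toReal = 0`) make the window empty. [cite: LSSY2005, (5.15); Fournais2020, Thm. 1.2] -/
def WindowBudgetFO : Prop :=
  LevelIncrement → FirstOrderLocalCondensation → DefectInSomeWindow

-- END DEFS

/-! ## S3′ is a weakening of the registered S3 (route item stmt-13194) -/

/-- `WindowLocalCondensation` (stmt-13194, ∀ η ∈ (0,1/4)) implies `FirstOrderLocalCondensation`
(∃ η): instantiate `η = 1/8`. Hence the line `firstorder_window` is never worse than `registered`.
[folklore] -/
theorem firstOrderLocalCondensation_of_windowLocalCondensation :
    BECDyadicChaining.WindowLocalCondensation → FirstOrderLocalCondensation := by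
  intro h v hv
  obtain ⟨γ, C, hγ, hC, ρ₀, hρ₀, H⟩ := h v hv (1 / 8) (by norm_num) (by norm_num)
  exact ⟨1 / 8, γ, C, by norm_num, hγ, hC, ρ₀, hρ₀, H⟩

/-! ## Audit aliases: the composition's hypotheses are the declared stubs BY NAME -/

namespace __Goal

/-- Audit alias of stub S1′ (`stub_defectAboveEveryWindow`): the statement `DefectAboveEveryWindow`. [folklore] -/
abbrev stub_defectAboveEveryWindow : Prop := DefectAboveEveryWindow

/-- Audit alias of stub S2 (`stub_levelIncrement`): the statement `LevelIncrement`. [folklore] -/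
abbrev stub_levelIncrement : Prop := LevelIncrement

/-- Audit alias of stub S3′ (`stub_firstOrderLocalCondensation`): the statement
`FirstOrderLocalCondensation`. [folklore] -/
abbrev stub_firstOrderLocalCondensation : Prop := FirstOrderLocalCondensation

/-- Audit alias of stub S4′ (`stub_windowBudgetFO`): the statement `WindowBudgetFO`. [folklore] -/
abbrev stub_windowBudgetFO : Prop := WindowBudgetFO

end __Goal

/-! ## Stubs (the ONLY `sorry`s of this file) -/

/-- **Stub S1′ (XL/open, HARDEST): coherence defect above every window** — see
`DefectAboveEveryWindow`. [cite: arXiv:2603.20776, Rem. 7; Leggett2001, §VI] -/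
theorem stub_defectAboveEveryWindow :
    ∀ v : ℝ → ℝ≥0∞, IsRepulsiveFiniteRange v → ∀ η : ℝ, 0 < η → η < 1 / 4 → ∀ ℓd : ℝ, 0 < ℓd →
      ∃ ρ₀ : ℝ, 0 < ρ₀ ∧ ∀ ρ : ℝ, 0 < ρ → ρ < ρ₀ →
        ∃ β : ℕ → ℝ, (∀ j, 0 ≤ β j) ∧ Summable β ∧ ∑' j, β j ≤ 1 / 8 ∧ ∀ᶠ N : ℕ in atTop,
          let a : ℝ := (scatteringLength v).toReal
          let L : ℝ := sideLength ρ N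
          let φ : (m : ℕ) → (Fin 3 → Fin (2 ^ m)) → EuclideanSpace ℝ (Fin 3) → ℂ := fun m i =>
            Set.indicator {x : EuclideanSpace ℝ (Fin 3) | ∀ k : Fin 3, x k ∈
                Set.Ioo (((i k : ℕ) : ℝ) * (L / 2 ^ m)) ((((i k : ℕ) : ℝ) + 1) * (L / 2 ^ m))}
              (fun _ => ((Real.sqrt ((L / 2 ^ m) ^ 3))⁻¹ : ℂ))
          ∃ δ : ℝ≥0∞, 0 < δ ∧ ∀ Ψ : TrialState N L, energy v Ψ ≤ groundStateEnergy v N L + δ →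
            let A : ℕ → ℝ≥0∞ := fun m => (8 : ℝ≥0∞) ^ (-(m : ℝ) / 2) *
              ∑ i : Fin 3 → Fin (2 ^ m), (occupation N (φ m i) Ψ.ψ) ^ (1 / 2 : ℝ)
            ∀ m j : ℕ, 1 ≤ m → ℓd * 2 ^ j ≤ L / 2 ^ m → L / 2 ^ m < ℓd * 2 ^ (j + 1) →
              (ρ * a) ^ (-(1 : ℝ) / 2) * (ρ * a ^ 3) ^ (-η) < L / 2 ^ m →
              A m ≤ A (m - 1) + ENNReal.ofReal (β j) * (N : ℝ≥0∞) ^ (1 / 2 : ℝ) := by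
  sorry

/-- **Stub S2 (M, provable now; IDENTICAL to the registered line's S2): level-occupation ladder and
increment bound** — see `LevelIncrement`. [cite: LSSY2005, §1.2 (1.17)] -/
theorem stub_levelIncrement :
    ∀ (N : ℕ) (L : ℝ) (Ψ : TrialState N L) (m : ℕ), 1 ≤ m →
      let φ : (m : ℕ) → (Fin 3 → Fin (2 ^ m)) → EuclideanSpace ℝ (Fin 3) → ℂ := fun m i =>
        Set.indicator {x : EuclideanSpace ℝ (Fin 3) | ∀ k : Fin 3, x k ∈
            Set.Ioo (((i k : ℕ) : ℝ) * (L / 2 ^ m)) ((((i k : ℕ) : ℝ) + 1) * (L / 2 ^ m))}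
          (fun _ => ((Real.sqrt ((L / 2 ^ m) ^ 3))⁻¹ : ℂ))
      let T : ℕ → ℝ≥0∞ := fun m => ∑ i : Fin 3 → Fin (2 ^ m), occupation N (φ m i) Ψ.ψ
      let A : ℕ → ℝ≥0∞ := fun m => (8 : ℝ≥0∞) ^ (-(m : ℝ) / 2) *
        ∑ i : Fin 3 → Fin (2 ^ m), (occupation N (φ m i) Ψ.ψ) ^ (1 / 2 : ℝ)
      T (m - 1) ≤ T m ∧ T m ≤ N ∧ A m ≤ A (m - 1) + (T m - T (m - 1)) ^ (1 / 2 : ℝ) := by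
  sorry

/-- **Stub S3′ (L/XL, first-order technology): local condensation on all dyadic scales up to SOME
window** — see `FirstOrderLocalCondensation`. [cite: LSSY2005, Lemma 5.2, Lemma 4.1, (5.15)] -/
theorem stub_firstOrderLocalCondensation :
    ∀ v : ℝ → ℝ≥0∞, IsRepulsiveFiniteRange v → ∃ η γ C : ℝ, 0 < η ∧ 2 * η < γ ∧ 0 ≤ C ∧
      ∃ ρ₀ : ℝ, 0 < ρ₀ ∧ ∀ ρ : ℝ, 0 < ρ → ρ < ρ₀ → ∀ᶠ N : ℕ in atTop,
        let a : ℝ := (scatteringLength v).toReal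
        let L : ℝ := sideLength ρ N
        let φ : (m : ℕ) → (Fin 3 → Fin (2 ^ m)) → EuclideanSpace ℝ (Fin 3) → ℂ := fun m i =>
          Set.indicator {x : EuclideanSpace ℝ (Fin 3) | ∀ k : Fin 3, x k ∈
              Set.Ioo (((i k : ℕ) : ℝ) * (L / 2 ^ m)) ((((i k : ℕ) : ℝ) + 1) * (L / 2 ^ m))}
            (fun _ => ((Real.sqrt ((L / 2 ^ m) ^ 3))⁻¹ : ℂ))
        ∃ δ : ℝ≥0∞, 0 < δ ∧ ∀ Ψ : TrialState N L, energy v Ψ ≤ groundStateEnergy v N L + δ →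
          ∀ m : ℕ, L / 2 ^ m ≤ (ρ * a) ^ (-(1 : ℝ) / 2) * (ρ * a ^ 3) ^ (-η) →
            ENNReal.ofReal ((1 - C * (ρ * a ^ 3) ^ γ * max 1 (ρ * a * (L / 2 ^ m) ^ 2)) * N) ≤
              ∑ i : Fin 3 → Fin (2 ^ m), occupation N (φ m i) Ψ.ψ := by
  sorry

/-- **Stub S4′ (M/L, bookkeeping with teeth): the window budget at the delivered exponent** — see
`WindowBudgetFO`. [cite: LSSY2005, (5.15); Fournais2020, Thm. 1.2] -/
theorem stub_windowBudgetFO :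
    (∀ (N : ℕ) (L : ℝ) (Ψ : TrialState N L) (m : ℕ), 1 ≤ m →
      let φ : (m : ℕ) → (Fin 3 → Fin (2 ^ m)) → EuclideanSpace ℝ (Fin 3) → ℂ := fun m i =>
        Set.indicator {x : EuclideanSpace ℝ (Fin 3) | ∀ k : Fin 3, x k ∈
            Set.Ioo (((i k : ℕ) : ℝ) * (L / 2 ^ m)) ((((i k : ℕ) : ℝ) + 1) * (L / 2 ^ m))}
          (fun _ => ((Real.sqrt ((L / 2 ^ m) ^ 3))⁻¹ : ℂ))
      let T : ℕ → ℝ≥0∞ := fun m => ∑ i : Fin 3 → Fin (2 ^ m), occupation N (φ m i) Ψ.ψ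
      let A : ℕ → ℝ≥0∞ := fun m => (8 : ℝ≥0∞) ^ (-(m : ℝ) / 2) *
        ∑ i : Fin 3 → Fin (2 ^ m), (occupation N (φ m i) Ψ.ψ) ^ (1 / 2 : ℝ)
      T (m - 1) ≤ T m ∧ T m ≤ N ∧ A m ≤ A (m - 1) + (T m - T (m - 1)) ^ (1 / 2 : ℝ)) →
    (∀ v : ℝ → ℝ≥0∞, IsRepulsiveFiniteRange v → ∃ η γ C : ℝ, 0 < η ∧ 2 * η < γ ∧ 0 ≤ C ∧
      ∃ ρ₀ : ℝ, 0 < ρ₀ ∧ ∀ ρ : ℝ, 0 < ρ → ρ < ρ₀ → ∀ᶠ N : ℕ in atTop,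
        let a : ℝ := (scatteringLength v).toReal
        let L : ℝ := sideLength ρ N
        let φ : (m : ℕ) → (Fin 3 → Fin (2 ^ m)) → EuclideanSpace ℝ (Fin 3) → ℂ := fun m i =>
          Set.indicator {x : EuclideanSpace ℝ (Fin 3) | ∀ k : Fin 3, x k ∈
              Set.Ioo (((i k : ℕ) : ℝ) * (L / 2 ^ m)) ((((i k : ℕ) : ℝ) + 1) * (L / 2 ^ m))}
            (fun _ => ((Real.sqrt ((L / 2 ^ m) ^ 3))⁻¹ : ℂ))
        ∃ δ : ℝ≥0∞, 0 < δ ∧ ∀ Ψ : TrialState N L, energy v Ψ ≤ groundStateEnergy v N L + δ →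
          ∀ m : ℕ, L / 2 ^ m ≤ (ρ * a) ^ (-(1 : ℝ) / 2) * (ρ * a ^ 3) ^ (-η) →
            ENNReal.ofReal ((1 - C * (ρ * a ^ 3) ^ γ * max 1 (ρ * a * (L / 2 ^ m) ^ 2)) * N) ≤
              ∑ i : Fin 3 → Fin (2 ^ m), occupation N (φ m i) Ψ.ψ) →
    ∀ v : ℝ → ℝ≥0∞, IsRepulsiveFiniteRange v → ∃ η : ℝ, 0 < η ∧ η < 1 / 4 ∧ ∃ ℓd : ℝ, 0 < ℓd ∧
      ∃ ρ₀ : ℝ, 0 < ρ₀ ∧ ∀ ρ : ℝ, 0 < ρ → ρ < ρ₀ →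
        ∃ β : ℕ → ℝ, (∀ j, 0 ≤ β j) ∧ Summable β ∧ ∑' j, β j ≤ 1 / 8 ∧ ∀ᶠ N : ℕ in atTop,
          let a : ℝ := (scatteringLength v).toReal
          let L : ℝ := sideLength ρ N
          let φ : (m : ℕ) → (Fin 3 → Fin (2 ^ m)) → EuclideanSpace ℝ (Fin 3) → ℂ := fun m i =>
            Set.indicator {x : EuclideanSpace ℝ (Fin 3) | ∀ k : Fin 3, x k ∈
                Set.Ioo (((i k : ℕ) : ℝ) * (L / 2 ^ m)) ((((i k : ℕ) : ℝ) + 1) * (L / 2 ^ m))}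
              (fun _ => ((Real.sqrt ((L / 2 ^ m) ^ 3))⁻¹ : ℂ))
          ∃ δ : ℝ≥0∞, 0 < δ ∧ ∀ Ψ : TrialState N L, energy v Ψ ≤ groundStateEnergy v N L + δ →
            let A : ℕ → ℝ≥0∞ := fun m => (8 : ℝ≥0∞) ^ (-(m : ℝ) / 2) *
              ∑ i : Fin 3 → Fin (2 ^ m), (occupation N (φ m i) Ψ.ψ) ^ (1 / 2 : ℝ)
            ∀ m j : ℕ, 1 ≤ m → ℓd * 2 ^ j ≤ L / 2 ^ m → L / 2 ^ m < ℓd * 2 ^ (j + 1) →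
              L / 2 ^ m ≤ (ρ * a) ^ (-(1 : ℝ) / 2) * (ρ * a ^ 3) ^ (-η) →
              A m ≤ A (m - 1) + ENNReal.ofReal (β j) * (N : ℝ≥0∞) ^ (1 / 2 : ℝ) := by
  sorry

/-! ## Composition (sorry-free): the four stubs give the crux BY NAME -/

/-- **`DyadicCoherenceDefect` from the four stubs.** Hypotheses = the four declared stubs BY NAME
(`__Goal.stub_*` aliases); conclusion = the route decl `BECDyadicChaining.DyadicCoherenceDefect`.
Glue: `(η, ℓ_d)` from the window part (S4′ S2 S3′), S1′ at that `(η, ℓ_d)`, `ρ₀ = min`,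
`β = β¹ + β²`, eventualities intersected, `δ = min`, and a case split `s_w < L/2^m` / `L/2^m ≤ s_w`
per level. [folklore] -/
theorem DyadicCoherenceDefect_of :
    __Goal.stub_defectAboveEveryWindow → __Goal.stub_levelIncrement →
      __Goal.stub_firstOrderLocalCondensation → __Goal.stub_windowBudgetFO →
      BECDyadicChaining.DyadicCoherenceDefect := by
  intro hU hI hF hWB
  have hW : DefectInSomeWindow := hWB hI hF
  intro v hv
  obtain ⟨η, hη0, hη4, ℓd, hℓd, ρ₂, hρ₂, HW⟩ := hW v hv
  obtain ⟨ρ₁, hρ₁, HU'⟩ := hU v hv η hη0 hη4 ℓd hℓd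
  refine ⟨ℓd, hℓd, min ρ₁ ρ₂, lt_min hρ₁ hρ₂, fun ρ hρ hρlt => ?_⟩
  obtain ⟨β₁, hβ₁0, hβ₁s, hβ₁t, E1⟩ := HU' ρ hρ (hρlt.trans_le (min_le_left _ _))
  obtain ⟨β₂, hβ₂0, hβ₂s, hβ₂t, E2⟩ := HW ρ hρ (hρlt.trans_le (min_le_right _ _))
  refine ⟨fun j => β₁ j + β₂ j, fun j => add_nonneg (hβ₁0 j) (hβ₂0 j), hβ₁s.add hβ₂s, ?_, ?_⟩
  · show ∑' j, (β₁ j + β₂ j) ≤ 1 / 4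
    rw [hβ₁s.tsum_add hβ₂s]
    linarith
  filter_upwards [E1, E2] with N hN1 hN2
  obtain ⟨δ₁, hδ₁, HΨ1⟩ := hN1
  obtain ⟨δ₂, hδ₂, HΨ2⟩ := hN2
  refine ⟨min δ₁ δ₂, lt_min hδ₁ hδ₂, fun Ψ hΨ => ?_⟩
  have h1 := HΨ1 Ψ (hΨ.trans (add_le_add le_rfl (min_le_left _ _)))
  have h2 := HΨ2 Ψ (hΨ.trans (add_le_add le_rfl (min_le_right _ _)))
  intro A m j hm hj1 hj2
  rcases lt_or_ge ((ρ * (scatteringLength v).toReal) ^ (-(1 : ℝ) / 2) *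
      (ρ * (scatteringLength v).toReal ^ 3) ^ (-η)) (sideLength ρ N / 2 ^ m) with hup | hin
  · exact (h1 m j hm hj1 hj2 hup).trans (add_le_add le_rfl (mul_le_mul'
      (ENNReal.ofReal_le_ofReal (le_add_of_nonneg_right (hβ₂0 j))) le_rfl))
  · exact (h2 m j hm hj1 hj2 hin).trans (add_le_add le_rfl (mul_le_mul'
      (ENNReal.ofReal_le_ofReal (le_add_of_nonneg_left (hβ₁0 j))) le_rfl))

end Summit.AtomisticToContinuum.BoseEinsteinCondensation.Cruxes.DyadicCoherenceDefect.FirstOrderWindow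

end
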